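import Mathlib
import HarnessLib
import Summits.ValiantsHypothesis.ValiantsHypothesis.Theses.MonotoneRestoration
import Literature.Computability.AlgebraicComplexity.ArithCircuit
import Literature.Computability.AlgebraicComplexity.ArithCircuitProofs
import Literature.Computability.AlgebraicComplexity.MonotoneStructure
import Literature.Computability.AlgebraicComplexity.PermanentIrreducible
import Literature.ModelTheory.FiniteModelTheory.CkEquiv
import Summits.ValiantsHypothesis.ValiantsHypothesis.Theorems.MonotoneRestorationMonotoneRestorationQPCosetCount
import Summits.ValiantsHypothesis.ValiantsHypothesis.Theorems.MonotoneRestorationMonotoneRestorationQPSymmetricLB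
import Summits.ValiantsHypothesis.ValiantsHypothesis.Theorems.MonotoneRestorationMonotoneRestorationQPSupportSymmetrisation
import Summits.ValiantsHypothesis.ValiantsHypothesis.Theorems.MonotoneRestorationMonotoneRestorationQPSparseRegime
import Summits.ValiantsHypothesis.ValiantsHypothesis.Theorems.MonotoneRestorationMonotoneRestorationQPBeta
import Literature.Computability.AlgebraicComplexity.SymmetricArithCircuit
import Literature.Computability.AlgebraicComplexity.DawarWilsenach2025Proofs
import Literature.GroupTheory.PermutationGroups.SmallIndexSubgroups
import Summits.ValiantsHypothesis.ValiantsHypothesis.Theorems.MonotoneRestorationQP.Negative.LoadBearing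
import Summits.ValiantsHypothesis.ValiantsHypothesis.Theorems.MonotoneRestorationMonotoneRestorationQPPermSupportCount

/-! TTRL-lite variant V19300 of stmt-ValiantsHypothesis-15886 -/

set_option linter.dupNamespace false

namespace Summit.ValiantsHypothesis.ValiantsHypothesis.Theorems

open Summit.ValiantsHypothesis.ValiantsHypothesis.Theses.MonotoneRestoration
open Literature.Computability.AlgebraicComplexity

/-- TTRL-lite variant V19300 of the registered stub `stub_gammaArithmetic` of
`stmt-ValiantsHypothesis-15886` (core growth step, polynomial vs. exponential): for every
exponent `d`, eventually `m ^ d ≤ 2 ^ m`. Derived from Mathlib's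
`isLittleO_pow_const_const_pow_of_one_lt` over `ℝ` with ratio `2` (little-o with constant `1`,
`Filter.eventually_atTop`), then cast back to `ℕ`. -/
theorem stub_gammaArithmetic_var19300 : ∀ (d : ℕ), ∃ M : ℕ, ∀ m : ℕ, M ≤ m → m ^ d ≤ 2 ^ m := by
  intro d
  have h := isLittleO_pow_const_const_pow_of_one_lt (R := ℝ) d (one_lt_two : (1 : ℝ) < 2)
  have h1 := h.def zero_lt_one
  rw [Filter.eventually_atTop] at h1
  obtain ⟨M, hM⟩ := h1
  refine ⟨M, fun m hm => ?_⟩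
  have h2 := hM m hm
  rw [one_mul, Real.norm_of_nonneg (by positivity), Real.norm_of_nonneg (by positivity)] at h2
  exact_mod_cast h2

end Summit.ValiantsHypothesis.ValiantsHypothesis.Theorems
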